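import Literature.MathematicalPhysics.QuantumLattice.SpinSectorPartitionFnRelabel
import Literature.MathematicalPhysics.QuantumLattice.HubbardNNNHoppingOpenClusters
import HarnessLib

/-!
# The finite-temperature cluster variational principle on the torus: the canonical partition function
# dominates the product of the open-cluster canonical partition functions

Family `hubbard` (topic `MathematicalPhysics/QuantumLattice`; positive-temperature companion of
`HubbardNNNHoppingOpenClusters` (zero temperature: `E_torus(Σ N_ij) ≤ Σ E_open(N_ij)`), built on the
two-block cut `ThermodynamicLimit.partitionFn_twoGraph_sector_cut_of_induced` (`SectorPartitionFnCut`) and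
the relabelling invariance of canonical partition functions (`SpinSectorPartitionFnRelabel`)). Written for
the `T > 0` certificate family of the Hubbard cell (sr-mbsolver/hubbard-thermal, technique (ii)): it is the
PRODUCER of certified free-energy UPPER bounds WITH ENTROPY — an exactly evaluated canonical partition
function of a small open cluster certifies `ℓ·L² ≤ log Z_{L,β}` for every torus made of such clusters,
the input of the hot chord of `TorusSectorGibbsEnergyWindow`.

For the two-graph Hamiltonians `H_{G,G'} = hamiltonian G t U + hamiltonian G' t' U'` and the spin-sector
(canonical) partition functions `Z_β(A; a, b) = Z_β(spinSectorHamiltonian a b A)`, `β ≥ 0`: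

* `one_le_partitionFn_spinSector_zero_re` — `1 ≤ Re Z_β(H; 0, 0)` (the vacuum; base of the inductions);
  `partitionFn_spinSector_re_nonneg` — `0 ≤ Re Z_β(A; a, b)`;
* `prod_partitionFn_strips_le` — STRIPS: for any two bond sets on `Fin (KM) ×ₗ Fin b`,
  `Π_i Re Z_β(H|strip i; a_i, b_i) ≤ Re Z_β(H; Σa_i, Σb_i)` (induced bond sets of the `K` strips);
* `partitionFn_spinSector_twoGraph_comap_rectSwap` — the coordinate swap does not change canonical
  partition functions; `prod_partitionFn_blocks_le` — BLOCKS: `Π_{ij} Re Z_β(H|block ij; a_ij, b_ij) ≤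
  Re Z_β(H; Σa_ij, Σb_ij)` on `Fin (K_x a) ×ₗ Fin (K_y b)`;
* `prod_partitionFn_openBox_le_rectTorus` — **the torus dominates the product of open boxes**: for
  `K_x, K_y ≥ 2`, `Π_{ij} Re Z_β(H^open_{a×b}; a_ij, b_ij) ≤ Re Z_β(H^torus_{K_x a × K_y b}; Σa_ij, Σb_ij)`,
  with `H^open = hubbardOpenBoxTT' a b t t' U`, `H^torus = hubbardRectTorusTT' (K_x a) (K_y b) t t' U`; uniform
  sectors: `pow_partitionFn_openBox_le_rectTorus`, and in logarithmic (free-energy) form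
  `mul_log_partitionFn_openBox_le_rectTorus`:
  `K_x K_y · log Re Z_β(H^open; a₀, b₀) ≤ log Re Z_β(H^torus; K_x K_y a₀, K_x K_y b₀)`.

Everything is PROVED; no definition, no named fact. (The bookkeeping identities for strips/blocks and the
identification of the induced bond sets of a torus block with the open-box bond sets are private in
`HubbardNNNHoppingOpenClusters`; their short proofs are redone here.)

## References

* D. Ruelle, *Statistical Mechanics: Rigorous Results* (1969), §3.3 Prop. 3.3.2 (b) eq. (3.5), 3.3.3
  eq. (3.11) (sub-additivity over sub-boxes), §2.5 (Peierls). [cite: Ruelle1969, §3.3]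
* R. B. Israel, *Convexity in the Theory of Lattice Gases* (1979), Lemma II.3.1. [cite: Israel1979, Lemma II.3.1]
* J. P. F. LeBlanc et al., Phys. Rev. X 5 (2015) 041041, eq. (1) (the `t–t'–U` model and its clusters).
  [cite: LeBlancEtAl2015, eq. (1)]
-/

noncomputable section

namespace Literature.MathematicalPhysics.QuantumLattice

open Matrix Finset HubbardWave0 ThermodynamicLimit LiebThm1
open scoped ComplexOrder BigOperators

/-! ### Nonnegativity; the vacuum bound -/

section Basic

variable {Λ : Type*} [LinearOrder Λ] [Fintype Λ]

/-- `0 ≤ Re Z_β(A; a, b)` for Hermitian `A` (a sum of exponentials; `0` on an empty sector).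
[cite: Israel1979, Lemma II.3.1] -/
theorem partitionFn_spinSector_re_nonneg (a b : ℕ) {A : Matrix (Finset (Orb Λ)) (Finset (Orb Λ)) ℂ}
    (hA : A.IsHermitian) (β : ℝ) : 0 ≤ (partitionFn β (spinSectorHamiltonian a b A)).re := by
  rw [(isHermitian_spinSectorHamiltonian a b hA).partitionFn_eq_ofReal, Complex.ofReal_re]
  exact sum_nonneg fun _ _ => (Real.exp_pos _).le

/-- **The vacuum bound** `1 ≤ Re Z_β(H_{G,G'}; 0, 0)`: the empty configuration is a unit vector of the
sector `(0, 0)` annihilated by both Hubbard Hamiltonians (Peierls' inequality for this one vector).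
[cite: Ruelle1969, §3.3] -/
theorem one_le_partitionFn_spinSector_zero_re (G G' : SimpleGraph Λ) [DecidableRel G.Adj]
    [DecidableRel G'.Adj] (t U t' U' β : ℝ) :
    1 ≤ (partitionFn β (spinSectorHamiltonian 0 0 (hamiltonian G t U + hamiltonian G' t' U'))).re := by
  have hH : (hamiltonian G t U + hamiltonian G' t' U').IsHermitian :=
    (hamiltonian_isHermitian G t U).add (hamiltonian_isHermitian G' t' U')
  set v : Unit → Fock (Orb Λ) := fun _ => vacuum with hv
  have hon : ∀ i j, star (v i) ⬝ᵥ v j = if i = j then 1 else 0 := by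
    intro i j
    rw [if_pos (Subsingleton.elim i j), hv]
    simp [vacuum]
  have hsupp : ∀ i s, ¬ spinConfig (Λ := Λ) 0 0 s → v i s = 0 := by
    intro i s hs
    rw [hv]
    simp only [vacuum]
    rw [Pi.single_apply, if_neg]
    rintro rfl
    exact hs ⟨by simp [upPart], by simp [downPart]⟩
  have h := hH.sum_exp_neg_mul_rayleigh_le_partitionFn_submatrix (spinConfig (Λ := Λ) 0 0) β hon hsupp
  rw [Fintype.sum_unique] at h
  have h0 : (star (v default) ⬝ᵥ ((hamiltonian G t U + hamiltonian G' t' U') *ᵥ v default)).re = 0 := by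
    rw [hv]
    simp only [add_mulVec, hamiltonian_mulVec_vacuum, add_zero, dotProduct_zero, Complex.zero_re]
  rw [h0, mul_zero, neg_zero, Real.exp_zero] at h
  exact h

/-- A spin sector `(a, b)` with `a, b ≤ |Λ|` is nonempty. [cite: LiebPRL1989, proof of Theorem 1] -/
theorem nonempty_spinConfig {a b : ℕ} (ha : a ≤ Fintype.card Λ) (hb : b ≤ Fintype.card Λ) :
    Nonempty (Subtype (spinConfig (Λ := Λ) a b)) := by
  classical
  obtain ⟨α, -, hα⟩ : ∃ α : Finset Λ, α ⊆ univ ∧ α.card = a :=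
    Finset.exists_subset_card_eq (by rw [Finset.card_univ]; exact ha)
  obtain ⟨γ, -, hγ⟩ : ∃ γ : Finset Λ, γ ⊆ univ ∧ γ.card = b :=
    Finset.exists_subset_card_eq (by rw [Finset.card_univ]; exact hb)
  exact ⟨⟨pairSet α γ, by rw [spinConfig, upPart_pairSet, downPart_pairSet, hα, hγ]; exact ⟨rfl, rfl⟩⟩⟩

/-- On a nonempty spin sector the canonical partition function of a Hermitian matrix is positive.
[cite: Israel1979, Lemma II.3.1] -/
theorem partitionFn_spinSector_re_pos {a b : ℕ} [Nonempty (Subtype (spinConfig (Λ := Λ) a b))]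
    {A : Matrix (Finset (Orb Λ)) (Finset (Orb Λ)) ℂ} (hA : A.IsHermitian) (β : ℝ) :
    0 < (partitionFn β (spinSectorHamiltonian a b A)).re := by
  rw [(isHermitian_spinSectorHamiltonian a b hA).partitionFn_eq_ofReal, Complex.ofReal_re]
  exact (isHermitian_spinSectorHamiltonian a b hA).sum_exp_pos β

end Basic

namespace ThermodynamicLimit

/-! ### Strips of `Fin A ×ₗ Fin b`, `A = K M` -/

section Strips

variable {b : ℕ}

/-- The lower block of the cut at `K M` followed by the `i`-th strip of `Fin (K M) ×ₗ Fin b` is the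
`i`-th strip of `Fin (K M + M) ×ₗ Fin b`. [folklore] -/
private theorem rectCastAdd_comp_stripEmb' {M K : ℕ} (h₁ : K * M = K * M) (h₂ : K * M + M = (K + 1) * M)
    (i : Fin K) :
    rectCastAdd (K * M) M b ∘ stripEmb h₁ i = stripEmb (b := b) h₂ (Fin.castSucc i) := by
  funext p
  refine ofLex.injective (Prod.ext (Fin.ext ?_) ?_)
  · simp [rectCastAdd, stripEmb]
  · simp [rectCastAdd, stripEmb]

/-- The upper block of the cut at `K M` is the last strip of `Fin (K M + M) ×ₗ Fin b`. [folklore] -/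
private theorem rectNatAdd_eq_stripEmb' {M K : ℕ} (h₂ : K * M + M = (K + 1) * M) :
    rectNatAdd (K * M) M b = stripEmb (b := b) h₂ (Fin.last K) := by
  funext p
  refine ofLex.injective (Prod.ext (Fin.ext ?_) ?_)
  · simp [rectNatAdd, stripEmb]
  · simp [rectNatAdd, stripEmb]

variable {Λ : Type*} [LinearOrder Λ] [Fintype Λ] in
/-- Two decidability structures on the same adjacency give the same Hubbard Hamiltonian. [folklore] -/
private theorem hamiltonian_congr' {G₁ G₂ : SimpleGraph Λ} [DecidableRel G₁.Adj] [DecidableRel G₂.Adj]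
    (h : G₁ = G₂) (t U : ℝ) : hamiltonian G₁ t U = hamiltonian G₂ t U := by
  subst h
  congr!

/-- **Strips multiply canonical partition functions.** For ANY two bond sets `G, G'` on
`Fin A ×ₗ Fin b`, `A = K M`, sector numbers `(a_i, b_i)` per strip and `β ≥ 0`:
`Π_i Re Z_β(H_{G|strip i, G'|strip i}; a_i, b_i) ≤ Re Z_β(H_{G,G'}; Σ_i a_i, Σ_i b_i)` (induced bond sets
of the strips `[iM, (i+1)M) × Fin b`; iterate the penalty-free cut, splitting off the last strip).
[cite: Ruelle1969, §3.3] -/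
theorem prod_partitionFn_strips_le (M : ℕ) (t U t' U' : ℝ) {β : ℝ} (hβ : 0 ≤ β) :
    ∀ (K A : ℕ) (hA : A = K * M) (G G' : SimpleGraph (Fin A ×ₗ Fin b)) [DecidableRel G.Adj]
      [DecidableRel G'.Adj] (as bs : Fin K → ℕ),
      ∏ i, (partitionFn β (spinSectorHamiltonian (as i) (bs i)
          (hamiltonian (G.comap (stripEmb hA i)) t U + hamiltonian (G'.comap (stripEmb hA i)) t' U'))).re ≤
        (partitionFn β (spinSectorHamiltonian (∑ i, as i) (∑ i, bs i)
          (hamiltonian G t U + hamiltonian G' t' U'))).re := by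
  intro K
  induction K with
  | zero =>
      intro A hA G G' _ _ as bs
      rw [Fin.prod_univ_zero, Fin.sum_univ_zero, Fin.sum_univ_zero]
      exact one_le_partitionFn_spinSector_zero_re G G' t U t' U' β
  | succ K ih =>
      intro A hA G G' _ _ as bs
      have hA' : A = K * M + M := by rw [hA]; ring
      subst hA'
      rw [Fin.prod_univ_castSucc, Fin.sum_univ_castSucc, Fin.sum_univ_castSucc]
      -- the cut into the lower `K` strips and the last strip (induced bond sets, no penalty)
      set e₁ : (Fin (K * M) ×ₗ Fin b) ↪ (Fin (K * M + M) ×ₗ Fin b) :=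
        ⟨rectCastAdd (K * M) M b, (strictMono_rectCastAdd (K * M) M b).injective⟩ with he₁
      set e₂ : (Fin M ×ₗ Fin b) ↪ (Fin (K * M + M) ×ₗ Fin b) :=
        ⟨rectNatAdd (K * M) M b, (strictMono_rectNatAdd (K * M) M b).injective⟩ with he₂
      have hcut := partitionFn_twoGraph_sector_cut_of_induced G G' (e₁ := e₁) (e₂ := e₂)
        (strictMono_rectCastAdd (K * M) M b) (strictMono_rectNatAdd (K * M) M b)
        (rectCastAdd_lt_rectNatAdd (K * M) M b) (rectCastAdd_cover (K * M) M b) t U t' U' hβ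
        (∑ i : Fin K, as (Fin.castSucc i)) (∑ i : Fin K, bs (Fin.castSucc i)) (as (Fin.last K))
        (bs (Fin.last K))
      have hE₁ : (e₁ : Fin (K * M) ×ₗ Fin b → Fin (K * M + M) ×ₗ Fin b) = rectCastAdd (K * M) M b := rfl
      have hE₂ : (e₂ : Fin M ×ₗ Fin b → Fin (K * M + M) ×ₗ Fin b) = rectNatAdd (K * M) M b := rfl
      rw [hE₁, hE₂] at hcut
      -- the lower block by induction
      have hih := ih (K * M) rfl (G.comap (rectCastAdd (K * M) M b)) (G'.comap (rectCastAdd (K * M) M b))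
        (fun i => as (Fin.castSucc i)) (fun i => bs (Fin.castSucc i))
      -- identify the strips
      have hG : ∀ i : Fin K, (G.comap (rectCastAdd (K * M) M b)).comap (stripEmb rfl i) =
          G.comap (stripEmb hA (Fin.castSucc i)) := by
        intro i
        rw [SimpleGraph.comap_comap, rectCastAdd_comp_stripEmb' rfl hA]
      have hG' : ∀ i : Fin K, (G'.comap (rectCastAdd (K * M) M b)).comap (stripEmb rfl i) =
          G'.comap (stripEmb hA (Fin.castSucc i)) := by
        intro i
        rw [SimpleGraph.comap_comap, rectCastAdd_comp_stripEmb' rfl hA]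
      have hL : G.comap (rectNatAdd (K * M) M b) = G.comap (stripEmb hA (Fin.last K)) := by
        rw [rectNatAdd_eq_stripEmb' hA]
      have hL' : G'.comap (rectNatAdd (K * M) M b) = G'.comap (stripEmb hA (Fin.last K)) := by
        rw [rectNatAdd_eq_stripEmb' hA]
      have hih' : ∏ i : Fin K, (partitionFn β (spinSectorHamiltonian (as (Fin.castSucc i)) (bs (Fin.castSucc i))
            (hamiltonian (G.comap (stripEmb hA (Fin.castSucc i))) t U +
              hamiltonian (G'.comap (stripEmb hA (Fin.castSucc i))) t' U'))).re ≤
          (partitionFn β (spinSectorHamiltonian (∑ i : Fin K, as (Fin.castSucc i))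
            (∑ i : Fin K, bs (Fin.castSucc i))
            (hamiltonian (G.comap (rectCastAdd (K * M) M b)) t U +
              hamiltonian (G'.comap (rectCastAdd (K * M) M b)) t' U'))).re := by
        refine le_trans (le_of_eq (Finset.prod_congr rfl fun i _ => ?_)) hih
        rw [hamiltonian_congr' (hG i), hamiltonian_congr' (hG' i)]
      rw [hamiltonian_congr' hL, hamiltonian_congr' hL'] at hcut
      -- combine: `Π_{<K} · last ≤ Z_lower · Z_last ≤ Z`
      have hlast : 0 ≤ (partitionFn β (spinSectorHamiltonian (as (Fin.last K)) (bs (Fin.last K))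
          (hamiltonian (G.comap (stripEmb hA (Fin.last K))) t U +
            hamiltonian (G'.comap (stripEmb hA (Fin.last K))) t' U'))).re :=
        partitionFn_spinSector_re_nonneg _ _
          ((hamiltonian_isHermitian _ t U).add (hamiltonian_isHermitian _ t' U')) β
      exact (mul_le_mul_of_nonneg_right hih' hlast).trans hcut

end Strips

/-! ### Blocks of `Fin A ×ₗ Fin B`: strips, transpose, strips -/

section Blocks

/-- **Transposition invariance of canonical partition functions for arbitrary bond sets**: pulling two
bond sets on `Fin A ×ₗ Fin B` back along the coordinate swap does not change the canonical partition
functions (`partitionFn_spinSector_hamiltonian₂_eq_of_iso` with the site bijection `rectSwap`).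
[cite: BratteliRobinsonII1997, §5.2.2, Thm. 5.2.5] -/
theorem partitionFn_spinSector_twoGraph_comap_rectSwap {A B : ℕ} (H H' : SimpleGraph (Fin A ×ₗ Fin B))
    [DecidableRel H.Adj] [DecidableRel H'.Adj] (t U t' U' β : ℝ) (a b : ℕ) :
    partitionFn β (spinSectorHamiltonian a b (hamiltonian (H.comap (rectSwap B A)) t U +
        hamiltonian (H'.comap (rectSwap B A)) t' U')) =
      partitionFn β (spinSectorHamiltonian a b (hamiltonian H t U + hamiltonian H' t' U')) :=
  partitionFn_spinSector_hamiltonian₂_eq_of_iso (rectSwap A B) H H' (H.comap (rectSwap B A))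
    (H'.comap (rectSwap B A)) (fun _ _ => Iff.rfl) (fun _ _ => Iff.rfl) t U t' U' β a b

/-- Strip `i` in the first coordinate, swap, strip `j`, swap back = block `(i, j)`. [folklore] -/
private theorem stripEmb_swap_stripEmb_swap' {a b Kx Ky A B : ℕ} (hA : A = Kx * a) (hB : B = Ky * b)
    (i : Fin Kx) (j : Fin Ky) :
    stripEmb (b := B) hA i ∘ rectSwap B a ∘ stripEmb (b := a) hB j ∘ rectSwap a b =
      blockEmb hA hB i j := by
  funext p
  rfl

/-- **Blocks multiply canonical partition functions.** For ANY two bond sets `G, G'` on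
`Fin A ×ₗ Fin B` with `A = K_x a`, `B = K_y b`, sector numbers `(a_ij, b_ij)` per block and `β ≥ 0`:
`Π_{ij} Re Z_β(H_{G|block ij, G'|block ij}; a_ij, b_ij) ≤ Re Z_β(H_{G,G'}; Σ a_ij, Σ b_ij)` (strips in the
first coordinate, the coordinate swap, strips again, swap back). [cite: Ruelle1969, §3.3] -/
theorem prod_partitionFn_blocks_le (a b : ℕ) (t U t' U' : ℝ) {β : ℝ} (hβ : 0 ≤ β) (Kx Ky A B : ℕ)
    (hA : A = Kx * a) (hB : B = Ky * b) (G G' : SimpleGraph (Fin A ×ₗ Fin B))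
    [DecidableRel G.Adj] [DecidableRel G'.Adj] (as bs : Fin Kx → Fin Ky → ℕ) :
    ∏ i, ∏ j, (partitionFn β (spinSectorHamiltonian (as i j) (bs i j)
        (hamiltonian (G.comap (blockEmb hA hB i j)) t U +
          hamiltonian (G'.comap (blockEmb hA hB i j)) t' U'))).re ≤
      (partitionFn β (spinSectorHamiltonian (∑ i, ∑ j, as i j) (∑ i, ∑ j, bs i j)
        (hamiltonian G t U + hamiltonian G' t' U'))).re := by
  -- strips in the first coordinate
  have h1 := prod_partitionFn_strips_le (b := B) a t U t' U' hβ Kx A hA G G' (fun i => ∑ j, as i j)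
    (fun i => ∑ j, bs i j)
  refine le_trans (Finset.prod_le_prod (fun i _ => Finset.prod_nonneg fun j _ =>
    partitionFn_spinSector_re_nonneg _ _
      ((hamiltonian_isHermitian _ t U).add (hamiltonian_isHermitian _ t' U')) β) fun i _ => ?_) h1
  -- strip `i`: swap, strips in the (new) first coordinate, swap back
  rw [← partitionFn_spinSector_twoGraph_comap_rectSwap (G.comap (stripEmb hA i)) (G'.comap (stripEmb hA i))]
  have h2 := prod_partitionFn_strips_le (b := a) b t U t' U' hβ Ky B hB
    ((G.comap (stripEmb hA i)).comap (rectSwap B a)) ((G'.comap (stripEmb hA i)).comap (rectSwap B a))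
    (fun j => as i j) (fun j => bs i j)
  refine le_trans (le_of_eq (Finset.prod_congr rfl fun j _ => ?_)) h2
  rw [← partitionFn_spinSector_twoGraph_comap_rectSwap
    ((((G.comap (stripEmb hA i)).comap (rectSwap B a))).comap (stripEmb hB j))
    ((((G'.comap (stripEmb hA i)).comap (rectSwap B a))).comap (stripEmb hB j))]
  have hG : (((G.comap (stripEmb hA i)).comap (rectSwap B a)).comap (stripEmb hB j)).comap
      (rectSwap a b) = G.comap (blockEmb hA hB i j) := by
    simp only [SimpleGraph.comap_comap]
    rw [← stripEmb_swap_stripEmb_swap' hA hB i j]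
    rfl
  have hG' : (((G'.comap (stripEmb hA i)).comap (rectSwap B a)).comap (stripEmb hB j)).comap
      (rectSwap a b) = G'.comap (blockEmb hA hB i j) := by
    simp only [SimpleGraph.comap_comap]
    rw [← stripEmb_swap_stripEmb_swap' hA hB i j]
    rfl
  rw [hamiltonian_congr' hG, hamiltonian_congr' hG']

end Blocks

end ThermodynamicLimit

/-! ### Open boxes inside the rectangular torus -/

section OpenBox

open ThermodynamicLimit

/-- For `K ≥ 2` blocks of length `M` on the ring `ℤ/KMℤ`, two sites of the SAME block are ring-neighbours
iff their positions in the block differ by one. [folklore] -/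
private theorem ringAdj_block_iff' {K M : ℕ} (hK : 2 ≤ K) (i : Fin K) (x x' : Fin M) :
    ringAdj (K * M) ((i : ℕ) * M + x) ((i : ℕ) * M + x') ↔ lineAdj x x' := by
  have hi : (i : ℕ) + 1 ≤ K := i.isLt
  have h1 : ((i : ℕ) + 1) * M ≤ K * M := Nat.mul_le_mul_right M hi
  have h2 : ((i : ℕ) + 1) * M = (i : ℕ) * M + M := by ring
  have h3 : 2 * M ≤ K * M := Nat.mul_le_mul_right M hK
  have hx := x.isLt
  have hx' := x'.isLt
  unfold ringAdj lineAdj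
  rcases Nat.lt_or_ge ((i : ℕ) * M + x + 1) (K * M) with hu | hu
  · rw [Nat.mod_eq_of_lt hu]
    rcases Nat.lt_or_ge ((i : ℕ) * M + x' + 1) (K * M) with hv | hv
    · rw [Nat.mod_eq_of_lt hv]; omega
    · rw [show (i : ℕ) * M + x' + 1 = K * M by omega, Nat.mod_self]; omega
  · rw [show (i : ℕ) * M + x + 1 = K * M by omega, Nat.mod_self]
    rcases Nat.lt_or_ge ((i : ℕ) * M + x' + 1) (K * M) with hv | hv
    · rw [Nat.mod_eq_of_lt hv]; omega
    · rw [show (i : ℕ) * M + x' + 1 = K * M by omega, Nat.mod_self]; omega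

/-- **The nearest-neighbour bonds of the torus inside a block are those of the open box** (`≥ 2` blocks
in each direction, so that no periodic bond stays inside a block). [cite: LeBlancEtAl2015, eq. (1)] -/
theorem comap_blockEmb_fermionRectTorusGraph' {a b Kx Ky A B : ℕ} (hKx : 2 ≤ Kx) (hKy : 2 ≤ Ky)
    (hA : A = Kx * a) (hB : B = Ky * b) (i : Fin Kx) (j : Fin Ky) :
    (fermionRectTorusGraph A B).comap (blockEmb hA hB i j) = rectBoxGraph a b := by
  subst hA hB
  ext p q
  rw [SimpleGraph.comap_adj, fermionRectTorusGraph_adj_iff]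
  simp only [blockEmb, ofLex_toLex, Fin.mk.injEq, Fin.val_mk, add_right_inj, Fin.val_inj]
  rw [ringAdj_block_iff' hKx i, ringAdj_block_iff' hKy j]
  rfl

/-- **The diagonal bonds of the torus inside a block are those of the open box** (`≥ 2` blocks in each
direction). [cite: LeBlancEtAl2015, eq. (1)] -/
theorem comap_blockEmb_fermionRectTorusDiagGraph' {a b Kx Ky A B : ℕ} (hKx : 2 ≤ Kx) (hKy : 2 ≤ Ky)
    (hA : A = Kx * a) (hB : B = Ky * b) (i : Fin Kx) (j : Fin Ky) :
    (fermionRectTorusDiagGraph A B).comap (blockEmb hA hB i j) = rectBoxDiagGraph a b := by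
  subst hA hB
  ext p q
  rw [SimpleGraph.comap_adj, fermionRectTorusDiagGraph_adj_iff]
  simp only [blockEmb, ofLex_toLex, Fin.val_mk]
  rw [ringAdj_block_iff' hKx i, ringAdj_block_iff' hKy j]
  rfl

/-- **The torus dominates the product of its open boxes** (finite-temperature cluster variational
principle for the `t–t'` Hubbard torus `ℤ/K_x aℤ × ℤ/K_y bℤ`, `K_x, K_y ≥ 2`, canonical ensemble): for
`β ≥ 0` and any block sector numbers `(a_ij, b_ij)`,
`Π_{ij} Re Z_β(H^open_{a×b}; a_ij, b_ij) ≤ Re Z_β(H^torus; Σ a_ij, Σ b_ij)` with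
`H^open = hubbardOpenBoxTT' a b t t' U` (free boundary conditions) and
`H^torus = hubbardRectTorusTT' (K_x a) (K_y b) t t' U` — the graded product of the canonical Gibbs states
of the boxes is a trial state of the torus whose free energy is the sum of the box free energies (every
torus bond joining two boxes has zero expectation). [cite: Ruelle1969, §3.3] [cite: LeBlancEtAl2015, eq. (1)] -/
theorem prod_partitionFn_openBox_le_rectTorus (a b Kx Ky : ℕ) (hKx : 2 ≤ Kx) (hKy : 2 ≤ Ky)
    (t t' U : ℝ) {β : ℝ} (hβ : 0 ≤ β) (as bs : Fin Kx → Fin Ky → ℕ) :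
    ∏ i, ∏ j, (partitionFn β (spinSectorHamiltonian (as i j) (bs i j) (hubbardOpenBoxTT' a b t t' U))).re ≤
      (partitionFn β (spinSectorHamiltonian (∑ i, ∑ j, as i j) (∑ i, ∑ j, bs i j)
        (hubbardRectTorusTT' (Kx * a) (Ky * b) t t' U))).re := by
  have h := prod_partitionFn_blocks_le a b t U t' 0 hβ Kx Ky (Kx * a) (Ky * b) rfl rfl
    (fermionRectTorusGraph (Kx * a) (Ky * b)) (fermionRectTorusDiagGraph (Kx * a) (Ky * b)) as bs
  refine le_trans (le_of_eq (Finset.prod_congr rfl fun i _ => Finset.prod_congr rfl fun j _ => ?_)) h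
  rw [hubbardOpenBoxTT', hamiltonian_congr' (comap_blockEmb_fermionRectTorusGraph' hKx hKy rfl rfl i j),
    hamiltonian_congr' (comap_blockEmb_fermionRectTorusDiagGraph' hKx hKy rfl rfl i j)]

/-- **Uniform sectors**: `(Re Z_β(H^open_{a×b}; a₀, b₀))^{K_x K_y} ≤ Re Z_β(H^torus_{K_x a × K_y b}; K_x K_y a₀, K_x K_y b₀)`
(`K_x, K_y ≥ 2`, `β ≥ 0`). [cite: Ruelle1969, §3.3] -/
theorem pow_partitionFn_openBox_le_rectTorus (a b Kx Ky : ℕ) (hKx : 2 ≤ Kx) (hKy : 2 ≤ Ky)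
    (t t' U : ℝ) {β : ℝ} (hβ : 0 ≤ β) (a₀ b₀ : ℕ) :
    (partitionFn β (spinSectorHamiltonian a₀ b₀ (hubbardOpenBoxTT' a b t t' U))).re ^ (Kx * Ky) ≤
      (partitionFn β (spinSectorHamiltonian (Kx * Ky * a₀) (Kx * Ky * b₀)
        (hubbardRectTorusTT' (Kx * a) (Ky * b) t t' U))).re := by
  have h := prod_partitionFn_openBox_le_rectTorus a b Kx Ky hKx hKy t t' U hβ (fun _ _ => a₀) (fun _ _ => b₀)
  have e1 : (∑ _i : Fin Kx, ∑ _j : Fin Ky, a₀) = Kx * Ky * a₀ := by simp [mul_assoc]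
  have e2 : (∑ _i : Fin Kx, ∑ _j : Fin Ky, b₀) = Kx * Ky * b₀ := by simp [mul_assoc]
  have e3 : ∀ z : ℝ, (∏ _i : Fin Kx, ∏ _j : Fin Ky, z) = z ^ (Kx * Ky) := by
    intro z
    simp only [Finset.prod_const, Finset.card_univ, Fintype.card_fin]
    rw [← pow_mul, mul_comm]
  rw [e3, e1, e2] at h
  exact h

/-- **Free-energy form**: `K_x K_y · log Re Z_β(H^open_{a×b}; a₀, b₀) ≤ log Re Z_β(H^torus; K_x K_y a₀, K_x K_y b₀)`
for a nonempty box sector (`a₀, b₀ ≤ ab`), `K_x, K_y ≥ 2`, `β ≥ 0` — i.e. per site, the canonical free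
energy of the torus is at most that of the open box: an exactly evaluated small-cluster canonical partition
function certifies a LOWER bound `ℓ·L²`, `ℓ = log Re Z_box/(ab)`, on the torus log-partition function.
[cite: Ruelle1969, §3.3] [cite: Israel1979, Lemma II.3.1] -/
theorem mul_log_partitionFn_openBox_le_rectTorus (a b Kx Ky : ℕ) (hKx : 2 ≤ Kx) (hKy : 2 ≤ Ky)
    (t t' U : ℝ) {β : ℝ} (hβ : 0 ≤ β) {a₀ b₀ : ℕ} (ha₀ : a₀ ≤ a * b) (hb₀ : b₀ ≤ a * b) :
    (Kx * Ky : ℝ) * Real.log (partitionFn β (spinSectorHamiltonian a₀ b₀ (hubbardOpenBoxTT' a b t t' U))).re ≤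
      Real.log (partitionFn β (spinSectorHamiltonian (Kx * Ky * a₀) (Kx * Ky * b₀)
        (hubbardRectTorusTT' (Kx * a) (Ky * b) t t' U))).re := by
  haveI : Nonempty (Subtype (spinConfig (Λ := Fin a ×ₗ Fin b) a₀ b₀)) :=
    nonempty_spinConfig (by rw [card_rectSites]; exact ha₀) (by rw [card_rectSites]; exact hb₀)
  have hpos : 0 < (partitionFn β (spinSectorHamiltonian a₀ b₀ (hubbardOpenBoxTT' a b t t' U))).re :=
    partitionFn_spinSector_re_pos (hubbardOpenBoxTT'_isHermitian a b t t' U) β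
  have h := pow_partitionFn_openBox_le_rectTorus a b Kx Ky hKx hKy t t' U hβ a₀ b₀
  have hlog := Real.log_le_log (pow_pos hpos _) h
  rw [Real.log_pow] at hlog
  exact_mod_cast hlog

end OpenBox

end Literature.MathematicalPhysics.QuantumLattice
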